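import Summits.PneNP.PneNP.Theorems.ExpanderLinearGeneratorsResolutionNFreeTwin
import HarnessLib

/-!
# The n-free resolution-size rung for expanding linear systems, VII: the 2-bit sum encoding

Support file for crux `stmt-PneNP-11442` (`ExpansionForcesDepthFregeSize`). The crux encodes an
`𝔽₂`-system `F` by `sumEncoding 1 F`; Beck–Impagliazzo's `sumEncoding B F` uses `B` Boolean
variables per unknown, read as their sum mod 2 (`B = 2`: the XOR-substituted system `F[⊕₂]`).
We identify `sumEncoding 2 F` with the 1-bit encoding of the DOUBLED system over `2n` variables
(`x_{2i}, x_{2i+1}` carrying the coefficient of `y_i`) — twin-closed under `x_{2i} ↔ x_{2i+1}`,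
`2ℓ`-sparse and `(r, 3/4·2ℓ)`-expanding when `F` is `ℓ`-sparse and `(r, 3ℓ/4)`-expanding — and
deduce from `resolution_size_twin` (file VI) the n-free EXPONENTIAL size law for the 2-bit
encoding on the crux's own hypotheses (`resolution_size_sumEncoding_two`): for `ℓ ≥ 1`, real
`r ≥ 2`, all `n, m`, every `ℓ`-sparse `F : Fin m → LinEqMod 2 n` with `(r, 3ℓ/4)`-boundary-
expanding supports, every resolution refutation of `sumEncoding 2 F` has `≥ (4/3)^{ℓ r / 8}`
lines. (For `sumEncoding 1` the tree has the law polynomially, file IV; its exponential form is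
not in print.)

References: E. Ben-Sasson, SIAM J. Comput. 38 (2009), §4 (substitution formulas); C. Beck,
R. Impagliazzo, STOC 2013 (sum encodings); J. Krajíček, *Proof complexity* (CUP 2019), §13.4.
-/

namespace Summit.PneNP.PneNP.Theorems.ResNFree

set_option linter.dupNamespace false -- `Summit.PneNP.PneNP.…`: summit = sub-problem (D-0017)

open Finset Literature.Computability.Complexity Literature.Computability.MetaComplexity
open Summit.PneNP.PneNP.Theorems.ResKRestriction

variable {m n : ℕ}

/-- `eqPred` depends on the true-variable list only through membership of block variables.
[folklore] -/
theorem eqPred_congr {p B : ℕ} (E : LinEqMod p n) {T T' : List ℕ}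
    (h : ∀ v ∈ eqVars B E, (v ∈ T ↔ v ∈ T')) : eqPred B E T = eqPred B E T' := by
  unfold eqPred
  have hs : ∀ i ∈ E.supp,
      ((encBlock B i).filter fun v => decide (v ∈ T)).length =
        ((encBlock B i).filter fun v => decide (v ∈ T')).length := by
    intro i hi
    congr 1
    refine List.filter_congr fun v hv => ?_
    exact decide_eq_decide.2 (h v (mem_eqVars.2 ⟨i, hi, hv⟩))
  rw [Finset.sum_congr rfl fun i hi => by rw [hs i hi]]

/-- `eqPred` on a variable list is the truth value of the equation under the indicator
assignment. [Beck 2017, Def. 5.6] [folklore] -/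
theorem eqPred_filter_eq_decide {p B : ℕ} (E : LinEqMod p n) (σ : ℕ → Bool) :
    eqPred B E ((eqVars B E).filter fun v => σ v) = decide (E.Holds (blockVals p B n σ)) := by
  rw [← eval_equationCNF B E σ, equationCNF, eval_canonicalCNF (nodup_eqVars B E)]

/-- **Canonical clauses transfer along a change of variable list with the same members and an
agreeing predicate.** [folklore] -/
theorem exists_canonical_clause {V₁ V₂ : List ℕ} (hV : ∀ v, v ∈ V₁ ↔ v ∈ V₂)
    (P₁ P₂ : List ℕ → Bool)
    (hP : ∀ T₁ T₂ : List ℕ, (∀ v, v ∈ T₁ ↔ v ∈ T₂) → P₁ T₁ = P₂ T₂)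
    {c : Clause ℕ} (hc : c ∈ canonicalCNF V₂ P₂) :
    ∃ c' ∈ canonicalCNF V₁ P₁, c'.toFinset = c.toFinset := by
  classical
  simp only [canonicalCNF, List.mem_map, List.mem_filter] at hc
  obtain ⟨S, ⟨hS, hPS⟩, rfl⟩ := hc
  set S₁ : List ℕ := V₁.filter fun v => decide (v ∈ S) with hS₁
  have hmem : ∀ v, v ∈ S₁ ↔ v ∈ S := by
    intro v
    simp only [hS₁, List.mem_filter, decide_eq_true_eq]
    constructor
    · exact fun h => h.2
    · intro h
      exact ⟨(hV v).2 ((List.mem_sublists.1 hS).subset h), h⟩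
  refine ⟨V₁.map fun v => (v, decide (v ∉ S₁)), ?_, ?_⟩
  · simp only [canonicalCNF, List.mem_map, List.mem_filter]
    refine ⟨S₁, ⟨List.mem_sublists.2 List.filter_sublist, ?_⟩, rfl⟩
    rw [hP S₁ S hmem]
    exact hPS
  · ext l
    simp only [List.mem_toFinset, List.mem_map]
    constructor
    · rintro ⟨v, hv, rfl⟩
      exact ⟨v, (hV v).1 hv, Prod.ext rfl (decide_eq_decide.2 (not_congr (hmem v))).symm⟩
    · rintro ⟨v, hv, rfl⟩
      exact ⟨v, (hV v).2 hv, Prod.ext rfl (decide_eq_decide.2 (not_congr (hmem v)))⟩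

/-- A refutation of `φ` refutes every CNF whose set-clauses include those of `φ`. [folklore] -/
theorem isResRefutation_of_clauseFinsets {φ ψ : CNF ℕ} {π : List (ResLine ℕ)}
    (hπ : IsResRefutation φ π) (h : ∀ C ∈ φ.clauseFinsets, C ∈ ψ.clauseFinsets) :
    IsResRefutation ψ π := by
  refine ⟨fun k hk => ?_, hπ.2⟩
  have hv := hπ.1 k hk
  rcases hl : (π[k]'hk).rule with _ | ⟨i, j, v⟩ | ⟨i⟩
  · simp only [IsValidResLine, hl] at hv ⊢
    exact h _ hv
  · simp only [IsValidResLine, hl] at hv ⊢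
    exact hv
  · simp only [IsValidResLine, hl] at hv ⊢
    exact hv

/-- Splitting a sum over `range (2n)` into even and odd indices. [folklore] -/
theorem sum_range_two_mul {M : Type*} [AddCommMonoid M] (f : ℕ → M) (n : ℕ) :
    ∑ u ∈ Finset.range (2 * n), f u = ∑ i ∈ Finset.range n, (f (2 * i) + f (2 * i + 1)) := by
  induction n with
  | zero => simp
  | succ n ih =>
    rw [show 2 * (n + 1) = 2 * n + 1 + 1 by ring, Finset.sum_range_succ, Finset.sum_range_succ, ih,
      Finset.sum_range_succ]
    abel

/-- The block of `y_i` in the 2-bit encoding is `[2i, 2i+1]`. [Beck 2017, Def. 5.6] [folklore] -/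
theorem encBlock_two (i : ℕ) : encBlock 2 i = [2 * i, 2 * i + 1] := by
  rw [show (2 : ℕ) = 0 + 1 + 1 from rfl]
  simp [xorBlock, List.range_succ, mul_comm]

/-- The block value of `y_i` in the 2-bit encoding: `[σ(2i)] + [σ(2i+1)]`. [folklore] -/
theorem blockVals_two_two_apply (n : ℕ) (σ : ℕ → Bool) (i : Fin n) :
    blockVals 2 2 n σ i =
      (if σ (2 * i) then 1 else 0) + (if σ (2 * i + 1) then 1 else 0) := by
  simp only [blockVals, blockVal, encBlock_two]
  by_cases h1 : σ (2 * i) = true <;> by_cases h2 : σ (2 * i + 1) = true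
  · simp [List.filter, h1, h2]
    norm_num
  · simp [List.filter, h1, h2]
  · simp [List.filter, h1, h2]
  · simp [List.filter, h1, h2]

/-! ### The doubled system of the 2-bit encoding -/

section Double

variable (F : Fin m → LinEqMod 2 n) (E : Fin m → LinEqMod 2 (2 * n))
  (hE1 : ∀ (k : Fin m) (v : Fin (2 * n)), (E k).1 v = (F k).1 ⟨v.1 / 2, Nat.div_lt_of_lt_mul v.2⟩)
  (hE2 : ∀ k : Fin m, (E k).2 = (F k).2)

include hE1 in
/-- Support of the doubled system: `x_v` occurs iff `y_{v/2}` does. [folklore] -/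
theorem mem_supp_double {k : Fin m} {v : Fin (2 * n)} :
    v ∈ (E k).supp ↔ (⟨v.1 / 2, Nat.div_lt_of_lt_mul v.2⟩ : Fin n) ∈ (F k).supp := by
  simp only [LinEqMod.supp, Finset.mem_filter, Finset.mem_univ, true_and, hE1]

include hE1 in
/-- Row variables of the doubled system: `u` iff `u < 2n` and `u/2` is a row variable of `F`.
[folklore] -/
theorem mem_rowVars_double {k : Fin m} {u : ℕ} :
    u ∈ rowVars E k ↔ u < 2 * n ∧ u / 2 ∈ rowVars F k := by
  constructor
  · intro hu
    obtain ⟨v, hv, rfl⟩ := mem_rowVars.1 hu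
    refine ⟨v.2, ?_⟩
    have h := (mem_supp_double F E hE1).1 hv
    exact val_mem_rowVars h
  · rintro ⟨hu, hu2⟩
    obtain ⟨j, hj, hju⟩ := mem_rowVars.1 hu2
    have hv : (⟨u, hu⟩ : Fin (2 * n)) ∈ (E k).supp := by
      rw [mem_supp_double F E hE1]
      have : (⟨u / 2, Nat.div_lt_of_lt_mul hu⟩ : Fin n) = j := Fin.ext hju.symm
      rw [this]; exact hj
    exact val_mem_rowVars hv

include hE1 in
/-- The two variables `2w`, `2w+1` of the doubled system are row variables iff `w` is one of `F`.
[folklore] -/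
theorem two_mul_add_mem_rowVars_double {k : Fin m} {w j : ℕ} (hj : j < 2) :
    2 * w + j ∈ rowVars E k ↔ w ∈ rowVars F k := by
  rw [mem_rowVars_double F E hE1]
  have h1 : (2 * w + j) / 2 = w := by omega
  rw [h1]
  constructor
  · exact fun h => h.2
  · intro h
    have := lt_of_mem_rowVars h
    exact ⟨by omega, h⟩

include hE1 hE2 in
/-- **Semantics**: the doubled system holds for the 1-bit values of `σ` iff `F` holds for the
2-bit values of `σ`. [Beck 2017, Def. 5.6] [folklore] -/
theorem holds_double_iff (k : Fin m) (σ : ℕ → Bool) :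
    (E k).Holds (blockVals 2 1 (2 * n) σ) ↔ (F k).Holds (blockVals 2 2 n σ) := by
  classical
  -- both sides as sums over `range n`
  set a : ℕ → ZMod 2 := fun u => if h : u < n then (F k).1 ⟨u, h⟩ else 0 with ha
  set s : ℕ → ZMod 2 := fun u => if σ u then 1 else 0 with hs
  have hL : ∑ v : Fin (2 * n), (E k).1 v * blockVals 2 1 (2 * n) σ v =
      ∑ i ∈ Finset.range n, a i * (s (2 * i) + s (2 * i + 1)) := by
    have h1 : ∀ v : Fin (2 * n), (E k).1 v * blockVals 2 1 (2 * n) σ v =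
        (fun u : ℕ => a (u / 2) * s u) v.1 := by
      intro v
      have hv : v.1 / 2 < n := Nat.div_lt_of_lt_mul v.2
      simp only [hE1, blockVals_two_one_apply, ha, hs, dif_pos hv]
    rw [Finset.sum_congr rfl fun v _ => h1 v, Fin.sum_univ_eq_sum_range (fun u => a (u / 2) * s u),
      sum_range_two_mul]
    refine Finset.sum_congr rfl fun i _ => ?_
    have h2 : 2 * i / 2 = i := by omega
    have h3 : (2 * i + 1) / 2 = i := by omega
    simp only [h2, h3]
    ring
  have hR : ∑ i : Fin n, (F k).1 i * blockVals 2 2 n σ i =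
      ∑ i ∈ Finset.range n, a i * (s (2 * i) + s (2 * i + 1)) := by
    have h1 : ∀ i : Fin n, (F k).1 i * blockVals 2 2 n σ i =
        (fun u : ℕ => a u * (s (2 * u) + s (2 * u + 1))) i.1 := by
      intro i
      simp only [blockVals_two_two_apply, ha, hs, dif_pos i.2, Fin.eta]
    rw [Finset.sum_congr rfl fun i _ => h1 i,
      Fin.sum_univ_eq_sum_range (fun u => a u * (s (2 * u) + s (2 * u + 1)))]
  simp only [LinEqMod.Holds, hL, hR, hE2]

include hE1 in
/-- The variable lists of row `k` under the two encodings have the same members. [folklore] -/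
theorem mem_eqVars_double_iff (k : Fin m) (u : ℕ) : u ∈ eqVars 1 (E k) ↔ u ∈ eqVars 2 (F k) := by
  rw [mem_eqVars, mem_eqVars]
  constructor
  · rintro ⟨v, hv, hu⟩
    rw [mem_encBlock] at hu
    obtain ⟨j, hj, rfl⟩ := hu
    have hj0 : j = 0 := by omega
    subst hj0
    refine ⟨⟨v.1 / 2, Nat.div_lt_of_lt_mul v.2⟩, (mem_supp_double F E hE1).1 hv, ?_⟩
    rw [mem_encBlock]
    exact ⟨v.1 % 2, Nat.mod_lt _ (by norm_num), by show v.1 * 1 + 0 = v.1 / 2 * 2 + v.1 % 2; omega⟩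
  · rintro ⟨i, hi, hu⟩
    rw [mem_encBlock] at hu
    obtain ⟨j, hj, rfl⟩ := hu
    have hlt : i.1 * 2 + j < 2 * n := by have := i.2; omega
    refine ⟨⟨i.1 * 2 + j, hlt⟩, ?_, ?_⟩
    · rw [mem_supp_double F E hE1]
      have : (⟨(i.1 * 2 + j) / 2, Nat.div_lt_of_lt_mul hlt⟩ : Fin n) = i :=
        Fin.ext (by show (i.1 * 2 + j) / 2 = i.1; omega)
      rw [this]; exact hi
    · rw [mem_encBlock]
      exact ⟨0, by norm_num, by simp⟩

include hE1 hE2 in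
/-- **The set-clauses of `sumEncoding 2 F` are set-clauses of the 1-bit encoding of the doubled
system.** [Beck 2017, Def. 5.6] [folklore] -/
theorem clauseFinsets_sumEncoding_two {C : Finset (Literal ℕ)}
    (hC : C ∈ (sumEncoding 2 F).clauseFinsets) : C ∈ (sumEncoding 1 E).clauseFinsets := by
  classical
  simp only [CNF.clauseFinsets, List.mem_map] at hC ⊢
  obtain ⟨c, hc, rfl⟩ := hC
  simp only [sumEncoding, List.mem_flatMap, List.mem_finRange, true_and] at hc
  obtain ⟨k, hck⟩ := hc
  have hP : ∀ T₁ T₂ : List ℕ, (∀ v, v ∈ T₁ ↔ v ∈ T₂) →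
      eqPred 1 (E k) T₁ = eqPred 2 (F k) T₂ := by
    intro T₁ T₂ hT
    set σ : ℕ → Bool := fun u => decide (u ∈ T₂) with hσ
    have h1 : eqPred 1 (E k) T₁ = eqPred 1 (E k) ((eqVars 1 (E k)).filter fun v => σ v) := by
      refine eqPred_congr (E k) fun v hv => ?_
      simp only [List.mem_filter, hσ, decide_eq_true_eq]
      exact ⟨fun h => ⟨hv, (hT v).1 h⟩, fun h => (hT v).2 h.2⟩
    have h2 : eqPred 2 (F k) T₂ = eqPred 2 (F k) ((eqVars 2 (F k)).filter fun v => σ v) := by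
      refine eqPred_congr (F k) fun v hv => ?_
      simp only [List.mem_filter, hσ, decide_eq_true_eq]
      exact ⟨fun h => ⟨hv, h⟩, fun h => h.2⟩
    rw [h1, h2, eqPred_filter_eq_decide, eqPred_filter_eq_decide]
    exact decide_eq_decide.2 (holds_double_iff F E hE1 hE2 k σ)
  obtain ⟨c', hc', hcc'⟩ := exists_canonical_clause (mem_eqVars_double_iff F E hE1 k)
    (eqPred 1 (E k)) (eqPred 2 (F k)) hP hck
  refine ⟨c', ?_, hcc'⟩
  simp only [sumEncoding, List.mem_flatMap, List.mem_finRange, true_and]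
  exact ⟨k, hc'⟩

include hE1 in
/-- The doubled system is `2ℓ`-sparse if `F` is `ℓ`-sparse. [folklore] -/
theorem card_supp_double_le (k : Fin m) : (E k).supp.card ≤ 2 * (F k).supp.card := by
  classical
  have hsub : (E k).supp ⊆ ((F k).supp ×ˢ (Finset.univ : Finset (Fin 2))).image
      fun p => (⟨2 * p.1.1 + p.2.1, by have := p.1.2; have := p.2.2; omega⟩ : Fin (2 * n)) := by
    intro v hv
    have hv' := (mem_supp_double F E hE1).1 hv
    refine Finset.mem_image.2 ⟨(⟨v.1 / 2, Nat.div_lt_of_lt_mul v.2⟩, ⟨v.1 % 2, Nat.mod_lt _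
      (by norm_num)⟩), Finset.mem_product.2 ⟨hv', Finset.mem_univ _⟩, ?_⟩
    ext
    show 2 * (v.1 / 2) + v.1 % 2 = v.1
    omega
  calc (E k).supp.card
      ≤ (((F k).supp ×ˢ (Finset.univ : Finset (Fin 2))).image fun p =>
          (⟨2 * p.1.1 + p.2.1, by have := p.1.2; have := p.2.2; omega⟩ : Fin (2 * n))).card :=
        Finset.card_le_card hsub
    _ ≤ ((F k).supp ×ˢ (Finset.univ : Finset (Fin 2))).card := Finset.card_image_le
    _ = 2 * (F k).supp.card := by
        rw [Finset.card_product, Finset.card_univ, Fintype.card_fin, mul_comm]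

include hE1 in
/-- **Expansion doubles**: if the supports of `F` form an `(r, c)`-boundary expander, those of the
doubled system form an `(r, 2c)`-boundary expander (each boundary point `u` of a family yields the
two boundary points `2u`, `2u+1`). [folklore] -/
theorem isBoundaryExpander_double {r c : ℝ} (hexp : IsBoundaryExpander (rowVars F) r c) :
    IsBoundaryExpander (rowVars E) r (2 * c) := by
  classical
  intro I hI
  have h1 := hexp I hI
  -- the injection `(u, j) ↦ 2u + j` of `∂_F I × Fin 2` into `∂_E I`
  have hmaps : ∀ p ∈ boundary (rowVars F) I ×ˢ (Finset.univ : Finset (Fin 2)),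
      (fun p : ℕ × Fin 2 => 2 * p.1 + p.2.1) p ∈ boundary (rowVars E) I := by
    intro p hp
    rw [Finset.mem_product] at hp
    obtain ⟨hu, -⟩ := hp
    rw [mem_boundary] at hu ⊢
    obtain ⟨hcov, hdeg⟩ := hu
    have hrow : ∀ i, 2 * p.1 + p.2.1 ∈ rowVars E i ↔ p.1 ∈ rowVars F i :=
      fun i => two_mul_add_mem_rowVars_double F E hE1 p.2.2
    constructor
    · obtain ⟨i, hi, hui⟩ := mem_cover.1 hcov
      exact mem_cover.2 ⟨i, hi, (hrow i).2 hui⟩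
    · unfold coverDegree at hdeg ⊢
      rw [Finset.filter_congr (fun i _ => hrow i)]
      exact hdeg
  have hinj : Set.InjOn (fun p : ℕ × Fin 2 => 2 * p.1 + p.2.1)
      ↑(boundary (rowVars F) I ×ˢ (Finset.univ : Finset (Fin 2))) := by
    intro p _ q _ h
    have hp := p.2.2
    have hq := q.2.2
    simp only at h
    refine Prod.ext ?_ (Fin.ext ?_) <;> omega
  have h2 : (boundary (rowVars F) I).card * 2 ≤ (boundary (rowVars E) I).card := by
    have := Finset.card_le_card_of_injOn _ hmaps hinj
    rwa [Finset.card_product, Finset.card_univ, Fintype.card_fin] at this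
  have h2' : ((boundary (rowVars F) I).card : ℝ) * 2 ≤ (boundary (rowVars E) I).card := by
    exact_mod_cast h2
  linarith

end Double

/-! ### The law for the 2-bit encoding -/

/-- **The n-free exponential resolution-size law for the 2-bit sum encoding of expanders.** For
`ℓ ≥ 1`, real `r ≥ 2`, all `n, m` and every `ℓ`-sparse system `F : Fin m → LinEqMod 2 n` whose
supports form an `(r, 3ℓ/4)`-boundary expander, every resolution refutation of `sumEncoding 2 F`
has at least `(4/3)^{ℓ r / 8}` lines. (The 2-bit encoding of `F` is the 1-bit encoding of the
doubled system, which is twin-closed, `2ℓ`-sparse and `(r, 3/4 · 2ℓ)`-expanding; apply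
`resolution_size_twin`.) [Ben-Sasson 2009, §4; Ben-Sasson–Wigderson 2001, Thm. 6.5] [folklore] -/
theorem resolution_size_sumEncoding_two (ℓ : ℕ) (hℓ : 1 ≤ ℓ) {r : ℝ} (hr : 2 ≤ r)
    (F : Fin m → LinEqMod 2 n) (hsparse : ∀ i, (F i).supp.card ≤ ℓ)
    (hexp : IsBoundaryExpander (fun i => (F i).supp.map Fin.valEmbedding) r (3 / 4 * ℓ))
    {π : List (ResLine ℕ)} (hπ : IsResRefutation (sumEncoding 2 F) π) :
    (4 / 3 : ℝ) ^ ((ℓ : ℝ) * r / 8) ≤ (π.length : ℝ) := by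
  classical
  set E : Fin m → LinEqMod 2 (2 * n) := fun k =>
    (fun v => (F k).1 ⟨v.1 / 2, Nat.div_lt_of_lt_mul v.2⟩, (F k).2) with hEdef
  have hE1 : ∀ (k : Fin m) (v : Fin (2 * n)),
      (E k).1 v = (F k).1 ⟨v.1 / 2, Nat.div_lt_of_lt_mul v.2⟩ := fun _ _ => rfl
  have hE2 : ∀ k : Fin m, (E k).2 = (F k).2 := fun _ => rfl
  -- sparsity and expansion of the doubled system
  have hsparseE : ∀ i, (E i).supp.card ≤ 2 * ℓ :=
    fun i => (card_supp_double_le F E hE1 i).trans (Nat.mul_le_mul_left 2 (hsparse i))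
  have hexpE : IsBoundaryExpander (fun i => (E i).supp.map Fin.valEmbedding) r
      (3 / 4 * ((2 * ℓ : ℕ) : ℝ)) := by
    have h := isBoundaryExpander_double F E hE1 hexp
    have heq : (3 : ℝ) / 4 * ((2 * ℓ : ℕ) : ℝ) = 2 * (3 / 4 * ℓ) := by push_cast; ring
    rw [heq]
    exact h
  -- the twin involution `2i ↔ 2i+1`
  set τ : Fin (2 * n) → Fin (2 * n) := fun v =>
    if h : v.1 % 2 = 0 then ⟨v.1 + 1, by have := v.2; omega⟩
    else ⟨v.1 - 1, by have := v.2; omega⟩ with hτdef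
  have hτval : ∀ v : Fin (2 * n), (τ v).1 = if v.1 % 2 = 0 then v.1 + 1 else v.1 - 1 := by
    intro v
    by_cases h : v.1 % 2 = 0
    · simp only [hτdef, dif_pos h, if_pos h]
    · simp only [hτdef, dif_neg h, if_neg h]
  have hτ : Function.Involutive τ := by
    intro v
    apply Fin.ext
    rw [hτval, hτval]
    by_cases h : v.1 % 2 = 0
    · rw [if_pos h]
      have h' : ¬ (v.1 + 1) % 2 = 0 := by omega
      rw [if_neg h']
      omega
    · rw [if_neg h]
      have h' : (v.1 - 1) % 2 = 0 := by omega
      rw [if_pos h']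
      omega
  have hτne : ∀ v, τ v ≠ v := by
    intro v h
    have h1 := congrArg Fin.val h
    rw [hτval] at h1
    by_cases h : v.1 % 2 = 0
    · rw [if_pos h] at h1; omega
    · rw [if_neg h] at h1; omega
  have hτhalf : ∀ v : Fin (2 * n), (τ v).1 / 2 = v.1 / 2 := by
    intro v
    rw [hτval]
    by_cases h : v.1 % 2 = 0
    · rw [if_pos h]; omega
    · rw [if_neg h]; omega
  have hsuppE : ∀ i v, τ v ∈ (E i).supp ↔ v ∈ (E i).supp := by
    intro i v
    rw [mem_supp_double F E hE1, mem_supp_double F E hE1]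
    have : (⟨(τ v).1 / 2, Nat.div_lt_of_lt_mul (τ v).2⟩ : Fin n)
        = ⟨v.1 / 2, Nat.div_lt_of_lt_mul v.2⟩ := Fin.ext (hτhalf v)
    rw [this]
  -- the refutation of `sumEncoding 2 F` refutes `sumEncoding 1 E`
  have hπE : IsResRefutation (sumEncoding 1 E) π :=
    isResRefutation_of_clauseFinsets hπ fun C hC => clauseFinsets_sumEncoding_two F E hE1 hE2 hC
  have h := resolution_size_twin (2 * ℓ) (by omega) hr E hsparseE hexpE τ hτ hτne hsuppE hπE
  have heq : (((2 * ℓ : ℕ) : ℝ)) * r / 16 = (ℓ : ℝ) * r / 8 := by push_cast; ring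
  rw [heq] at h
  exact h

end Summit.PneNP.PneNP.Theorems.ResNFree
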